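import Literature.NumberTheory.LFunctions.DeBruijnNewman
import Mathlib.Analysis.SpecialFunctions.Pow.Real
import Mathlib.Analysis.Convex.SpecificFunctions.Basic
import HarnessLib

/-!
# Csordas–Smith–Varga 1994: Lehmer pairs of zeros and the lower bound `λ_k ≤ Λ` (typed statements)

RH-FREE LITERATURE (label line, cell rh-crit C3): this module types, as printed, the DEFINITION of
a *Lehmer pair of zeros* and the *Lehmer-pair lower bound* for the de Bruijn–Newman constant `Λ` of
G. Csordas, W. Smith, R. S. Varga, *Lehmer pairs of zeros, the de Bruijn–Newman constant `Λ`, and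
the Riemann Hypothesis*, Constr. Approx. 10 (1994) 107–129 (`[CsordasSmithVarga1994]`, "Theorem 1"
in the numbering quoted by Rodgers–Tao 2020, §1: "See [csv, Theorem 1] for a precise statement").
Nothing here bears on the truth of RH: in the tree `0 ≤ Λ` is a THEOREM
(`Literature.NumberTheory.LFunctions.deBruijnNewmanConst_nonneg_holds`, via Dobner / Rodgers–Tao),
which dominates every printed Lehmer-pair bound `λ_k ≤ Λ` (`λ_k < 0`); the CONTENT of the
Csordas–Smith–Varga argument (the backward-heat-flow dynamics of a close pair of zeros) is recorded
below as the printed proof architecture and is NOT formalised by this file.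

## Source discipline

The primary text is cite-only in this tree (acquisition `acq-00171`). Every statement below is
typed from HELD SECONDARY restatements that quote it, in the tree's normalisation, and carries
BOTH locators:

* `[SaouterGourdonDemichel2011]` Y. Saouter, X. Gourdon, P. Demichel, *An improved lower bound for
  the de Bruijn–Newman constant*, Math. Comp. 80 (2011) 2281–2287, §2 p. 2282: **Definition A**
  (Lehmer pair, display (2.1) for `G_k`) and **Theorem A** ("the main theorem from [CSV94]",
  display (2.2) for `λ_k`), with `H_λ(x) = ∫₀^∞ e^{λu²} Φ(u) cos(xu) du`,
  `Φ(u) = Σ_{n ≥ 1} (2π²n⁴e^{9u} − 3πn²e^{5u}) exp(−πn²e^{4u})`, `H_0(x) = Ξ(x/2)/8` (p. 2281) — this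
  IS the tree's `Literature.NumberTheory.LFunctions.deBruijnH` / `deBruijnPhi` / `deBruijnNewmanConst`
  (`DeBruijnNewman.lean`, Rodgers–Tao eq. (1)–(3)), so no conversion factor arises;
* `[Stopple2016]` J. Stopple, *Lehmer pairs revisited*, Exp. Math. 26 (2017) 45–53 =
  arXiv:1508.05870, §3 (arXiv p. 4): "Definition" and "Theorem (Csordas et al.)" in the variable
  `γ` (zeros of `Ξ(t)`, i.e. `x = 2γ`); the Lehmer condition `Δ² g < 4/5` is scale invariant and
  `λ`, `Λ` scale together, so the two restatements agree;
* `[Stopple2014]` J. Stopple, *Notes on low discriminants and the generalized Newman conjecture*,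
  Funct. Approx. Comment. Math. 51 (2014) = arXiv:1301.3158, §§2–3 (arXiv pp. 3–5), which re-proves
  the theorem in the quadratic-Dirichlet setting "following [CSV]'s exposition closely" and prints
  the lemma structure (CSV Lemma 2.1, Lemma 2.4, Lemma 2.5, Theorem 1) used in the proof sketch below.

## Contents (namespace `Literature.NumberTheory.LFunctions`)

Definitions (real, with bodies):
* `lehmerPairSum t a b` — `G = Σ_{x} (1/(a − x)² + 1/(b − x)²)`, the sum over the real zeros `x` of
  `H_t` other than `a`, `b` (SGD (2.1): `G_k = Σ_{j ≠ 0,k,k+1} [(x_k − x_j)⁻² + (x_{k+1} − x_j)⁻²]`,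
  the `x_j`, `j ∈ ℤ ∖ {0}`, `x_{−j} = −x_j`, enumerating the zeros of `H_0`; Stopple's `g`);
* `lehmerPairBound d G` — `λ = ((1 − (5/4) d² G)^{4/5} − 1)/(8G)` (SGD (2.2), Stopple (Th. CSV));
* `IsLehmerPair t a b` — `0 < a < b` are consecutive simple real zeros of `H_t` with
  `(b − a)² · G < 4/5` (SGD Definition A / Stopple Definition, at `t = 0`; typed for every `t`).

Named fact (D-0014; the printed theorem, `t = 0`):
* `csordasSmithVarga_lehmerPair_bound` — a Lehmer pair `(a, b)` of `H_0` gives `λ ≤ Λ`.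

Proved here (elementary API, all as printed): `lehmerPairSum_nonneg`; the sandwich
`−1/(8G) < λ < 0` ("so that `−1/(8G_k) < λ_k < 0`", SGD p. 2282, Stopple p. 4) as
`neg_inv_lt_lehmerPairBound` / `lehmerPairBound_neg`; `lehmerPairBound_nonpos` (junk-inclusive);
the Taylor-type sandwich `−(5/32) d² ≤ λ ≤ −d²/8` behind SGD's remark "`λ_k` is close to
`−(x_{k+1} − x_k)²/8`"; and the defining identity `(1 + 8Gλ)^{5/4} = 1 − (5/4) d² G`
(`rpow_one_add_mul_lehmerPairBound`), which is the step "by choosing `t = λ`" of the printed proof.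

## The printed proof (architecture only; Stopple 2014 §§2–3 after CSV §2; NOT formalised here)

For `Λ < t` the zeros `x_j(t)` of `H_t` are real and simple (CSV Cor. 1 / Thm. 2.2 — the tree's
THEOREM `csordasSmithVarga_simple_zeros_holds`) and move by `x_k' = Σ'_{j ≠ k} 2/(x_k − x_j)`
(CSV Lemma 2.4 = Rodgers–Tao 2020 Thm. 4.1; typed by seat rt-t3, NOT restated here). For a
consecutive pair with gap `Δ = x_{k+1} − x_k` this gives `(Δ²)' = 8 − 2fΔ²` with
`0 < f = Σ' 2/((x_k − x_j)(x_{k+1} − x_j)) < G`, and CSV Lemma 2.5 `G' > −8G²`; integrating from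
`t < 0` to `0`: `e^{F(t)} Δ(t)² = Δ(0)² − 8∫_t^0 e^{F}`, `F(t) = −2∫_t^0 f > ¼ log(1 + 8G(0)t)`, so
`8∫_t^0 e^F > (4/5)(1 − (1 + 8G(0)t)^{5/4})/G(0)`, which exceeds `Δ(0)²` exactly at
`t = λ` (`rpow_one_add_mul_lehmerPairBound`); a flow of real simple zeros down to time `λ` would
force `Δ(λ)² < 0`, so `λ ≤ Λ` (Stopple prints the strict `λ < Λ`; SGD/Stopple 2016 print `≤`, typed).
The same argument run from any time `t₀` in place of `0` would give `t₀ + λ(t₀) ≤ Λ`; that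
time-translated form is NOT printed in the held sources and is therefore NOT typed (GAP-LEDGER
candidate: it is the content-bearing, `Λ ≥ 0`-independent version).

## Divergences (rendering choices, each flagged in the docstrings)

* The pair is addressed by its two abscissae `(a, b)` rather than by the index `k` of the
  enumeration `0 < x_1 ≤ x_2 ≤ ⋯` (SGD) — "consecutive" is rendered "no real zero of `H_t` strictly
  between `a` and `b`", which is what the index form says; the indexed form via the tree's
  enumeration `deBruijnZero t k` (`RodgersTaoEnergy.lean`) is a one-line specialisation for `t > Λ`.
* `G` sums over the REAL zeros of `H_t` (a `tsum` over a subtype of `ℝ`; junk value `0` if not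
  summable, which does not happen: `Σ x_j⁻² < ∞`). SGD §2 p. 2282 state the definition under the
  standing assumption "the zeros of `H_0` are all real and simple" (RH; otherwise `Λ > 0` and every
  negative lower bound is "trivially correct", loc. cit.), under which the two sums coincide.
* Printed range: `t = 0` only (both secondaries); `IsLehmerPair` and `lehmerPairSum` are DEFINED for
  every `t` (free generality of a definition), the FACT is stated at `t = 0` as printed.
* Not typed: Stopple 2016's "strong Lehmer pairs" (§4, pre-Schwarzian criterion, his Theorem 1) and
  the "infinitely many Lehmer pairs ⇒ `Λ = 0` [under RH]" remark (Stopple p. 4; in the tree it is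
  superseded by the theorem `0 ≤ Λ`); SGD Theorem B (the COSV93 numerical bound for `G_K`) and the
  record `Λ > −1.14541·10⁻¹¹` (SGD abstract), likewise dominated by `0 ≤ Λ`.

## References

* G. Csordas, W. Smith, R. S. Varga, *Lehmer pairs of zeros, the de Bruijn–Newman constant `Λ`, and
  the Riemann Hypothesis*, Constr. Approx. 10 (1994) 107–129, Theorem 1, Lemmas 2.1/2.4/2.5.
  [CsordasSmithVarga1994] (cite-only, acq-00171)
* Y. Saouter, X. Gourdon, P. Demichel, *An improved lower bound for the de Bruijn–Newman constant*,
  Math. Comp. 80 (2011) 2281–2287, Definition A, Theorem A, (2.1), (2.2), p. 2282.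
  [SaouterGourdonDemichel2011]
* J. Stopple, *Lehmer pairs revisited*, Exp. Math. 26 (2017) 45–53 = arXiv:1508.05870, §3.
  [Stopple2016]
* J. Stopple, *Notes on low discriminants and the generalized Newman conjecture*, Funct. Approx.
  Comment. Math. 51 (2014) = arXiv:1301.3158, §§2–3 (Lemmas "2.1/2.4/2.5 [CSV]", Theorem 1).
  [Stopple2014]
* B. Rodgers, T. Tao, *The de Bruijn–Newman constant is non-negative*, Forum Math. Pi 8 (2020) e6,
  §1 (Table 1; "[csv, Theorem 1]"). [RodgersTaoFMP2020]
-/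

noncomputable section

open Complex Set

namespace Literature.NumberTheory.LFunctions

/-! ## The functional `G` and the bound `λ` -/

/-- CSV's functional `G` of a pair of abscissae `a, b` at time `t`:
`G = Σ_x (1/(a − x)² + 1/(b − x)²)`, the sum running over the real zeros `x` of `H_t = deBruijnH t`
other than `a` and `b` (Saouter–Gourdon–Demichel 2011, (2.1) p. 2282:
`G_k = Σ_{j ≠ 0,k,k+1} [(x_k − x_j)⁻² + (x_{k+1} − x_j)⁻²]` over the enumerated zeros `x_j`,
`j ∈ ℤ ∖ {0}`, `x_{−j} = −x_j`, of `H_0`; Stopple 2016 §3 p. 4: `g = Σ_{γ ≠ γ₋,γ₊} …`). Rendered as a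
`tsum` over the subtype of real zeros (junk `0` if not summable; SGD state it under "the zeros of
`H_0` are all real and simple", when it is the printed sum). Defined for every `t`; printed at `t = 0`.
[cite: SaouterGourdonDemichel2011, Def. A (2.1) p. 2282] [cite: CsordasSmithVarga1994, Thm. 1] -/
def lehmerPairSum (t a b : ℝ) : ℝ :=
  ∑' x : {x : ℝ // deBruijnH t x = 0 ∧ x ≠ a ∧ x ≠ b},
    (1 / (a - (x : ℝ)) ^ 2 + 1 / (b - (x : ℝ)) ^ 2)

/-- Unfolding lemma for `lehmerPairSum` (SGD display (2.1)). [cite: SaouterGourdonDemichel2011, Def. A (2.1) p. 2282] -/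
theorem lehmerPairSum_eq (t a b : ℝ) :
    lehmerPairSum t a b = ∑' x : {x : ℝ // deBruijnH t x = 0 ∧ x ≠ a ∧ x ≠ b},
      (1 / (a - (x : ℝ)) ^ 2 + 1 / (b - (x : ℝ)) ^ 2) := rfl

/-- `G ≥ 0`: every term `1/(a − x)² + 1/(b − x)²` of SGD's display (2.1) is non-negative (and the
junk value is `0`). [cite: SaouterGourdonDemichel2011, Def. A (2.1) p. 2282] -/
theorem lehmerPairSum_nonneg (t a b : ℝ) : 0 ≤ lehmerPairSum t a b :=
  tsum_nonneg fun _ ↦ by positivity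

/-- CSV's Lehmer-pair bound `λ = ((1 − (5/4) d² G)^{4/5} − 1) / (8 G)` for a pair with gap `d` and
functional `G` (Saouter–Gourdon–Demichel 2011, (2.2) p. 2282:
`λ_k = ((1 − (5/4)(x_{k+1} − x_k)² G_k)^{4/5} − 1)/(8 G_k)`; Stopple 2016 §3 p. 4:
`λ = ((1 − 5Δ²g/4)^{4/5} − 1)/(8g)`). Junk: for `G = 0` the value is `0` (`x/0 = 0`); for
`(5/4) d² G > 1` the real power of a negative base is Mathlib's junk `Real.rpow` — the printed
hypothesis `d² G < 4/5` excludes both. [cite: SaouterGourdonDemichel2011, Thm. A (2.2) p. 2282]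
[cite: CsordasSmithVarga1994, Thm. 1] -/
def lehmerPairBound (d G : ℝ) : ℝ :=
  ((1 - 5 / 4 * d ^ 2 * G) ^ (4 / 5 : ℝ) - 1) / (8 * G)

/-- Unfolding lemma for `lehmerPairBound` (SGD display (2.2)). [cite: SaouterGourdonDemichel2011, Thm. A (2.2) p. 2282] -/
theorem lehmerPairBound_eq (d G : ℝ) :
    lehmerPairBound d G = ((1 - 5 / 4 * d ^ 2 * G) ^ (4 / 5 : ℝ) - 1) / (8 * G) := rfl

/-- Junk case of SGD's display (2.2): `λ = 0` when `G = 0` (Mathlib `x / 0 = 0`).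
[cite: SaouterGourdonDemichel2011, Thm. A (2.2) p. 2282] -/
@[simp] theorem lehmerPairBound_zero_right (d : ℝ) : lehmerPairBound d 0 = 0 := by
  simp [lehmerPairBound]

/-- `λ < 0` for a genuine Lehmer pair ("so that `−1/(8G_k) < λ_k < 0`", Saouter–Gourdon–Demichel
2011 p. 2282; Stopple 2016 p. 4): if `G > 0`, `d ≠ 0` and `d² G < 4/5` then the base
`1 − (5/4) d² G` lies in `(0, 1)`, so its `4/5`-th power is `< 1`.
[cite: SaouterGourdonDemichel2011, Thm. A p. 2282] -/
theorem lehmerPairBound_neg {d G : ℝ} (hG : 0 < G) (hd : d ≠ 0) (h : d ^ 2 * G < 4 / 5) :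
    lehmerPairBound d G < 0 := by
  have hd2 : 0 < d ^ 2 := by positivity
  have hb0 : 0 ≤ 1 - 5 / 4 * d ^ 2 * G := by nlinarith
  have hb1 : 1 - 5 / 4 * d ^ 2 * G < 1 := by nlinarith [mul_pos hd2 hG]
  have hpow : (1 - 5 / 4 * d ^ 2 * G) ^ (4 / 5 : ℝ) < 1 :=
    Real.rpow_lt_one hb0 hb1 (by norm_num)
  rw [lehmerPairBound]
  exact div_neg_of_neg_of_pos (by linarith) (by positivity)

/-- `−1/(8G) < λ` ("so that `−1/(8G_k) < λ_k < 0`", Saouter–Gourdon–Demichel 2011 p. 2282; "note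
`−1/8g(0) < λ`", Stopple 2014 Thm. 1): for `G > 0` and `d² G < 4/5` the base is positive, so its
`4/5`-th power is positive. [cite: SaouterGourdonDemichel2011, Thm. A p. 2282] -/
theorem neg_inv_lt_lehmerPairBound {d G : ℝ} (hG : 0 < G) (h : d ^ 2 * G < 4 / 5) :
    -1 / (8 * G) < lehmerPairBound d G := by
  have hb0 : 0 < 1 - 5 / 4 * d ^ 2 * G := by nlinarith
  have hpow : 0 < (1 - 5 / 4 * d ^ 2 * G) ^ (4 / 5 : ℝ) := Real.rpow_pos_of_pos hb0 _
  rw [lehmerPairBound, div_lt_div_iff_of_pos_right (by positivity)]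
  linarith

/-- `λ ≤ 0` whenever `G ≥ 0` and `d² G ≤ 4/5` (junk-inclusive form of the printed `λ_k < 0`,
SGD Thm. A p. 2282: the value is `0` for `G = 0`). [cite: SaouterGourdonDemichel2011, Thm. A p. 2282] -/
theorem lehmerPairBound_nonpos {d G : ℝ} (hG : 0 ≤ G) (h : d ^ 2 * G ≤ 4 / 5) :
    lehmerPairBound d G ≤ 0 := by
  rcases hG.eq_or_lt with rfl | hG'
  · simp
  have hd2 : 0 ≤ d ^ 2 := sq_nonneg d
  have hb0 : 0 ≤ 1 - 5 / 4 * d ^ 2 * G := by nlinarith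
  have hb1 : 1 - 5 / 4 * d ^ 2 * G ≤ 1 := by nlinarith [mul_nonneg hd2 hG]
  have hpow : (1 - 5 / 4 * d ^ 2 * G) ^ (4 / 5 : ℝ) ≤ 1 := Real.rpow_le_one hb0 hb1 (by norm_num)
  rw [lehmerPairBound]
  exact div_nonpos_of_nonpos_of_nonneg (by linarith) (by positivity)

/-- The defining identity of `λ`: `(1 + 8 G λ)^{5/4} = 1 − (5/4) d² G` for `G > 0`, `d² G < 4/5` —
the step "by choosing in the inequality (key) the value of `t` to be `λ`" of the printed proof
(Stopple 2014, Thm. 1, arXiv p. 4: `2∫_λ^0 exp F > γ₁²` because `(1 − (1 + 8g(0)λ)^{5/4})/(5g(0)) = γ₁²`).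
[cite: Stopple2014, Thm. 1 (proof)] -/
theorem rpow_one_add_mul_lehmerPairBound {d G : ℝ} (hG : 0 < G) (h : d ^ 2 * G < 4 / 5) :
    (1 + 8 * G * lehmerPairBound d G) ^ (5 / 4 : ℝ) = 1 - 5 / 4 * d ^ 2 * G := by
  have hb0 : 0 ≤ 1 - 5 / 4 * d ^ 2 * G := by nlinarith
  have hG8 : 8 * G ≠ 0 := by positivity
  have h1 : 1 + 8 * G * lehmerPairBound d G = (1 - 5 / 4 * d ^ 2 * G) ^ (4 / 5 : ℝ) := by
    rw [lehmerPairBound, mul_div_assoc', mul_comm (8 * G), mul_div_assoc, div_self hG8, mul_one]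
    ring
  rw [h1, ← Real.rpow_mul hb0]
  norm_num

/-- Upper half of the Taylor sandwich: `λ ≤ −d²/8` for `G > 0`, `d² G < 4/5` (Bernoulli:
`(1 − u)^{4/5} ≤ 1 − (4/5) u`), the precise form of "`λ_k` is close to `−(x_{k+1} − x_k)²/8`"
(Saouter–Gourdon–Demichel 2011 p. 2282) and of the expansion `λ = −½γ₁²(1 + ½γ₁²g(0) + …)`
(Stopple 2014, after Thm. 1; `d = 2γ₁`). [cite: SaouterGourdonDemichel2011, §2 p. 2282] -/
theorem lehmerPairBound_le {d G : ℝ} (hG : 0 < G) (h : d ^ 2 * G < 4 / 5) :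
    lehmerPairBound d G ≤ -(d ^ 2) / 8 := by
  have hs : -1 ≤ -(5 / 4 * d ^ 2 * G) := by nlinarith
  have hpow : (1 + -(5 / 4 * d ^ 2 * G)) ^ (4 / 5 : ℝ) ≤ 1 + 4 / 5 * -(5 / 4 * d ^ 2 * G) :=
    rpow_one_add_le_one_add_mul_self hs (by norm_num) (by norm_num)
  have hpow' : (1 - 5 / 4 * d ^ 2 * G) ^ (4 / 5 : ℝ) ≤ 1 - d ^ 2 * G := by
    rw [sub_eq_add_neg]; linarith
  rw [lehmerPairBound, div_le_div_iff₀ (by positivity) (by norm_num)]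
  nlinarith

/-- Lower half of the Taylor sandwich: `−(5/32) d² ≤ λ` for `G > 0`, `d² G < 4/5`
(`(1 − u)^{4/5} ≥ 1 − u` for `0 ≤ u ≤ 1`). [cite: SaouterGourdonDemichel2011, §2 p. 2282] -/
theorem neg_mul_sq_le_lehmerPairBound {d G : ℝ} (hG : 0 < G) (h : d ^ 2 * G < 4 / 5) :
    -(5 / 32 * d ^ 2) ≤ lehmerPairBound d G := by
  have hd2 : 0 ≤ d ^ 2 := sq_nonneg d
  have hb0 : 0 ≤ 1 - 5 / 4 * d ^ 2 * G := by nlinarith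
  have hb1 : 1 - 5 / 4 * d ^ 2 * G ≤ 1 := by nlinarith [mul_nonneg hd2 hG.le]
  have hpow : (1 - 5 / 4 * d ^ 2 * G) ^ (1 : ℝ) ≤ (1 - 5 / 4 * d ^ 2 * G) ^ (4 / 5 : ℝ) :=
    Real.rpow_le_rpow_of_exponent_ge' hb0 hb1 (by norm_num) (by norm_num)
  rw [Real.rpow_one] at hpow
  rw [lehmerPairBound, le_div_iff₀ (by positivity)]
  nlinarith

/-! ## Lehmer pairs of zeros (CSV Definition; SGD Definition A; Stopple §3 Definition) -/

/-- **Lehmer pair of zeros** of `H_t = deBruijnH t` (Csordas–Smith–Varga 1994; as printed in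
Saouter–Gourdon–Demichel 2011, Definition A p. 2282: "Let `k` be a positive integer such that `x_k`
and `x_{k+1}` are successive simple zeros of `H_0`. Then `(x_k, x_{k+1})` is a Lehmer pair of zeros
for `H_0` if we have `(x_{k+1} − x_k)² · G_k < 4/5`", and in Stopple 2016 §3 p. 4: "Let
`0 < γ₋ < γ₊` be two consecutive simple positive zeros of `Ξ(t)` […] `Δ = γ₊ − γ₋` […] Then
`{γ₋, γ₊}` is a Lehmer pair if `Δ² g < 4/5`"). Rendering: the pair is given by its abscissae
`0 < a < b`, both simple real zeros of `H_t` (`H_t(a) = 0`, `H_t'(a) ≠ 0`, likewise `b`), consecutive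
(no real zero of `H_t` strictly between them), with `(b − a)² · G < 4/5`, `G = lehmerPairSum t a b`.
Printed at `t = 0`; defined for every `t`. Divergence: abscissae instead of the index `k`; `G` over
real zeros (see `lehmerPairSum`). [cite: SaouterGourdonDemichel2011, Def. A p. 2282]
[cite: Stopple2016, §3 Definition (arXiv p. 4)] [cite: CsordasSmithVarga1994, Thm. 1 (Definition)] -/
structure IsLehmerPair (t a b : ℝ) : Prop where
  /-- `0 < a`: the pair consists of positive zeros. -/
  pos : 0 < a
  /-- `a < b`. -/
  lt : a < b
  /-- `a` is a zero of `H_t`. -/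
  zero_left : deBruijnH t a = 0
  /-- `b` is a zero of `H_t`. -/
  zero_right : deBruijnH t b = 0
  /-- `a` is a simple zero: `H_t'(a) ≠ 0`. -/
  simple_left : deriv (deBruijnH t) a ≠ 0
  /-- `b` is a simple zero: `H_t'(b) ≠ 0`. -/
  simple_right : deriv (deBruijnH t) b ≠ 0
  /-- The zeros are consecutive: no real zero of `H_t` strictly between `a` and `b`. -/
  consecutive : ∀ x : ℝ, a < x → x < b → deBruijnH t x ≠ 0
  /-- The Lehmer condition `(b − a)² · G < 4/5`. -/
  sq_mul_lt : (b - a) ^ 2 * lehmerPairSum t a b < 4 / 5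

namespace IsLehmerPair

variable {t a b : ℝ}

/-- The gap `Δ = b − a` of a Lehmer pair is positive (`x_k < x_{k+1}`, SGD Def. A; `Δ = γ₊ − γ₋ > 0`,
Stopple §3). [cite: SaouterGourdonDemichel2011, Def. A p. 2282] -/
theorem gap_pos (h : IsLehmerPair t a b) : 0 < b - a := sub_pos.2 h.lt

/-- `b > 0` for a Lehmer pair (`0 < γ₋ < γ₊`, Stopple 2016 §3 Definition).
[cite: Stopple2016, §3 Definition (arXiv p. 4)] -/
theorem pos_right (h : IsLehmerPair t a b) : 0 < b := h.pos.trans h.lt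

/-- For a Lehmer pair the bound `λ` is non-positive (it is `< 0` as soon as some third real zero
makes `G > 0`, `lehmerPairBound_neg` — the printed `λ_k < 0` of SGD Thm. A; `0` in the junk case
`G = 0`). [cite: SaouterGourdonDemichel2011, Thm. A p. 2282] -/
theorem lehmerPairBound_nonpos (h : IsLehmerPair t a b) :
    lehmerPairBound (b - a) (lehmerPairSum t a b) ≤ 0 :=
  LFunctions.lehmerPairBound_nonpos (lehmerPairSum_nonneg t a b) h.sq_mul_lt.le

/-- For a Lehmer pair with `G > 0`: `−1/(8G) < λ < 0` (Saouter–Gourdon–Demichel 2011, Thm. A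
p. 2282, "so that `−1/(8G_k) < λ_k < 0`"). [cite: SaouterGourdonDemichel2011, Thm. A p. 2282] -/
theorem lehmerPairBound_mem_Ioo (h : IsLehmerPair t a b) (hG : 0 < lehmerPairSum t a b) :
    lehmerPairBound (b - a) (lehmerPairSum t a b) ∈ Ioo (-1 / (8 * lehmerPairSum t a b)) 0 :=
  ⟨neg_inv_lt_lehmerPairBound hG h.sq_mul_lt, lehmerPairBound_neg hG h.gap_pos.ne' h.sq_mul_lt⟩

end IsLehmerPair

/-! ## The Lehmer-pair lower bound for `Λ` (CSV Theorem 1; SGD Theorem A) — named fact -/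

/-- NAMED FACT — **Csordas–Smith–Varga 1994, Theorem 1** (numbering as quoted by Rodgers–Tao
2020 §1), as printed in Saouter–Gourdon–Demichel 2011, **Theorem A** p. 2282: "Let `(x_k, x_{k+1})`
be a Lehmer pair of zeros for `H_0`. Set `λ_k = ((1 − (5/4)(x_{k+1} − x_k)² G_k)^{4/5} − 1)/(8G_k)`,
so that `−1/(8G_k) < λ_k < 0`. Then the de Bruijn–Newman constant `Λ` satisfies the inequality
`Λ ≥ λ_k`", and in Stopple 2016 §3 p. 4, "Theorem (Csordas et al.)": "`λ ≤ Λ`". RH-FREE as a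
statement; in the tree it is DOMINATED by the theorem `0 ≤ Λ`
(`deBruijnNewmanConst_nonneg_holds`), since `λ ≤ 0` (`IsLehmerPair.lehmerPairBound_nonpos`) — a
discharge by that route carries no Csordas–Smith–Varga content (the zero-dynamics proof sketched in
the module docstring). Printed range `t = 0`, typed at `t = 0`. Users take
`(h : csordasSmithVarga_lehmerPair_bound)`. [cite: CsordasSmithVarga1994, Thm. 1]
[cite: SaouterGourdonDemichel2011, Thm. A p. 2282] [cite: Stopple2016, §3 Theorem (arXiv p. 4)] -/
def csordasSmithVarga_lehmerPair_bound : Prop :=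
  ∀ a b : ℝ, IsLehmerPair 0 a b →
    lehmerPairBound (b - a) (lehmerPairSum 0 a b) ≤ deBruijnNewmanConst

/-- The named fact in the `λ_k`-free form used for records: a Lehmer pair `(a, b)` of `H_0` with
`G > 0` gives `−1/(8G) < Λ` (Theorem A with "`−1/(8G_k) < λ_k`").
[cite: SaouterGourdonDemichel2011, Thm. A p. 2282] -/
theorem csordasSmithVarga_lehmerPair_bound.neg_inv_lt (h : csordasSmithVarga_lehmerPair_bound)
    {a b : ℝ} (hab : IsLehmerPair 0 a b) (hG : 0 < lehmerPairSum 0 a b) :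
    -1 / (8 * lehmerPairSum 0 a b) < deBruijnNewmanConst :=
  (hab.lehmerPairBound_mem_Ioo hG).1.trans_le (h a b hab)

end Literature.NumberTheory.LFunctions

end
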